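import Summits.SmoothPoincare4.SmoothPoincare4.Theorems.ConvexBisectionAcyclicBisectionExistsCrossingNumberPassages
import HarnessLib

/-!
# The crossing number of a page loop making finitely many clean passages
(wave 3, brick Z6-8 — a tool for the evaluation step (γ) and the symmetry step of the missing lemma
`crossingNumber_eq_stdSymp` of node N1a `node_M3c_shadow_pageDehnTwist` (Picard–Lefschetz on
shadows) of stub `stub_modelsOnFibred_of_reach` = NF4, line `modp-braid-orbits`, crux
`ConvexBisection.AcyclicBisectionExists`, item stmt-SmoothPoincare4-10508; registered sub-goal
`helper_crossingNumber_passages`)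

The general form of `crossingNumber_single_passage` (`…CrossingNumberPassages.lean`): if the
unit-period loop of a page curve `K` runs inside the open annulus of the chart `φ` on finitely many
parameter intervals `[sₖ, tₖ] ⊆ [0, 1]` (`k < n`, in increasing order, `tₖ ≤ sₖ₊₁`) and off the
closed collar outside the open intervals `(sₖ, tₖ)`, then

  **`crossingNumber φ K = Σₖ (outerInd φ (K e^{2πitₖ}) − outerInd φ (K e^{2πisₖ}))`**

(`crossingNumber_eq_sum_passages`, `helper_crossingNumber_passages`): each passage contributes
`[hₖ(tₖ) ≥ 1/2] − [hₖ(sₖ) ≥ 1/2] ∈ {−1, 0, 1}`, i.e. `+1` if it climbs through the collar, `−1` if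
it descends, `0` if it returns to the side it came from.  Proof: the passage formula
`crossingNumber_eq_sum_inside` for the breakpoints `0, s₀, t₀, s₁, t₁, …, t_{n−1}, 1`, the
intermediate pieces contributing nothing (`outerInd_eq_of_piece` when such a piece happens to run
inside the annulus); `Finset.sum_range_parity` splits the sum.

Everything is proved; no definitions, no named facts, no `sorry`.  References: W. Fulton,
*Algebraic Topology: A First Course* (1995), §3 (degree by counting signed preimages) [Fulton1995].
-/

noncomputable section

set_option linter.dupNamespace false

open scoped Manifold ContDiff Topology Real
open Set Function Metric Filter
open Literature.Topology.FourManifolds Literature.Topology.FourManifolds.LefschetzBase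

namespace Summit.SmoothPoincare4.SmoothPoincare4.Theorems.AcyclicBisectionExists.ModpBraidOrbits

variable {g : ℕ} {c : ℂ} {φ : ℝ × ℝ → Base g} {K : sphere (0 : EuclideanSpace ℝ (Fin 2)) 1 → Base g}

/-- Splitting a sum over `range (2n + 1)` by parity: even indices `2k`, `k ≤ n`, and odd indices
`2k + 1`, `k < n`. [folklore] -/
theorem Finset.sum_range_parity {M : Type*} [AddCommMonoid M] (f : ℕ → M) (n : ℕ) :
    ∑ i ∈ Finset.range (2 * n + 1), f i =
      ∑ k ∈ Finset.range (n + 1), f (2 * k) + ∑ k ∈ Finset.range n, f (2 * k + 1) := by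
  induction n with
  | zero => simp
  | succ n ih =>
    rw [show 2 * (n + 1) + 1 = (2 * n + 1) + 1 + 1 by ring, Finset.sum_range_succ,
      Finset.sum_range_succ, ih, Finset.sum_range_succ (fun k => f (2 * k)) (n + 1),
      Finset.sum_range_succ (fun k => f (2 * k + 1)) n,
      show 2 * n + 1 + 1 = 2 * (n + 1) by ring]
    abel

/-- The interleaved breakpoints `0, s₀, t₀, s₁, t₁, …, t_{n−1}, 1` of `n` passages. [folklore] -/
theorem passageBreak_spec (s t : ℕ → ℝ) (n : ℕ) :
    ∃ b : ℕ → ℝ, b 0 = 0 ∧ (∀ k < n, b (2 * k + 1) = s k) ∧ (∀ k < n, b (2 * k + 2) = t k) ∧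
      b (2 * n + 1) = 1 ∧ ∀ k, n ≤ k → b (2 * k + 2) = 1 := by
  refine ⟨fun i => if i = 0 then 0 else if 2 * n + 1 ≤ i then 1 else
    if i % 2 = 1 then s (i / 2) else t (i / 2 - 1), rfl, fun k hk => ?_, fun k hk => ?_, ?_, fun k hk => ?_⟩
  · have h1 : (2 * k + 1) % 2 = 1 := by omega
    have h2 : (2 * k + 1) / 2 = k := by omega
    simp only [Nat.add_one_ne_zero, if_false, if_neg (show ¬ (2 * n + 1 ≤ 2 * k + 1) by omega),
      h1, if_true, h2]
  · have h1 : (2 * k + 2) % 2 ≠ 1 := by omega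
    have h2 : (2 * k + 2) / 2 - 1 = k := by omega
    simp only [Nat.add_one_ne_zero, if_false, if_neg (show ¬ (2 * n + 1 ≤ 2 * k + 2) by omega),
      if_neg h1, h2]
  · simp only [Nat.add_one_ne_zero, if_false, le_refl, if_true]
  · simp only [Nat.add_one_ne_zero, if_false, if_pos (show 2 * n + 1 ≤ 2 * k + 2 by omega)]

open Classical in
/-- **The crossing number of a loop making `n` clean passages** through the annulus of the chart,
on the parameter intervals `[sₖ, tₖ]` (increasing, `tₖ ≤ sₖ₊₁`), off the closed collar outside the
open intervals `(sₖ, tₖ)`: `crossingNumber φ K = Σₖ (outerInd (K e^{2πitₖ}) − outerInd (K e^{2πisₖ}))`.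
[cite: Fulton1995, §3] -/
theorem crossingNumber_eq_sum_passages (hc : ‖c‖ = 1) (hφc : Continuous φ)
    (hφ1 : ∀ u r, φ (u + 1, r) = φ (u, r)) (hφp : ∀ p, φ p ∈ page g c)
    (hφi : InjOn φ (Ico (0 : ℝ) 1 ×ˢ Ioo (-1 : ℝ) 1)) (hK : Continuous K)
    (hKc : ∀ θ, K θ ∈ page g c) {n : ℕ} (s t : ℕ → ℝ) (h0 : 0 ≤ s 0) (hst : ∀ k < n, s k ≤ t k)
    (hts : ∀ k, k + 1 < n → t k ≤ s (k + 1)) (h1 : ∀ k < n, t k ≤ 1)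
    (hin : ∀ k < n, ∀ τ ∈ Icc (s k) (t k), K (circlePt τ) ∈ φ '' (univ ×ˢ Ioo (-1 : ℝ) 1))
    (hout : ∀ τ ∈ Icc (0 : ℝ) 1, (∀ k < n, τ ∉ Ioo (s k) (t k)) →
      K (circlePt τ) ∉ φ '' (univ ×ˢ Icc (-(1 / 2) : ℝ) (1 / 2))) :
    crossingNumber φ K = ∑ k ∈ Finset.range n,
      (outerInd φ (K (circlePt (t k))) - outerInd φ (K (circlePt (s k)))) := by
  classical
  obtain ⟨b, hb0, hbs, hbt, hb1, -⟩ := passageBreak_spec s t n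
  -- monotonicity of all `s k`, `t k`
  have hmono_st : ∀ k < n, ∀ k' < n, k ≤ k' → s k ≤ s k' ∧ t k ≤ t k' := by
    intro k hk k' hk' hkk'
    induction k' with
    | zero =>
      obtain rfl : k = 0 := by omega
      exact ⟨le_rfl, le_rfl⟩
    | succ k' ih =>
      rcases Nat.eq_or_lt_of_le hkk' with rfl | hlt
      · exact ⟨le_rfl, le_rfl⟩
      · have h := ih (by omega) (by omega)
        exact ⟨h.1.trans ((hst k' (by omega)).trans (hts k' hk')),
          h.2.trans ((hts k' hk').trans (hst (k' + 1) hk'))⟩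
  have hmono : ∀ i < 2 * n + 1, b i ≤ b (i + 1) := by
    intro i hi
    obtain ⟨k, rfl | rfl⟩ : ∃ k, i = 2 * k ∨ i = 2 * k + 1 := ⟨i / 2, by omega⟩
    · -- piece `[b (2k), b (2k+1)]`: `[0 or t (k-1), s k or 1]`
      have hlow : b (2 * k) = 0 ∨ ∃ k', k = k' + 1 ∧ b (2 * k) = t k' := by
        rcases Nat.eq_zero_or_pos k with rfl | hk
        · exact Or.inl hb0
        · refine Or.inr ⟨k - 1, by omega, ?_⟩
          rw [show 2 * k = 2 * (k - 1) + 2 by omega, hbt (k - 1) (by omega)]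
      have hup : (k < n ∧ b (2 * k + 1) = s k) ∨ (k = n ∧ b (2 * k + 1) = 1) := by
        rcases lt_or_ge k n with hk | hk
        · exact Or.inl ⟨hk, hbs k hk⟩
        · obtain rfl : k = n := by omega
          exact Or.inr ⟨rfl, hb1⟩
      rcases hlow with hl | ⟨k', rfl, hl⟩ <;> rcases hup with ⟨hk, hu⟩ | ⟨hk, hu⟩ <;> rw [hl, hu]
      · exact h0.trans (hmono_st 0 (by omega) k hk (Nat.zero_le _)).1
      · exact zero_le_one
      · exact hts k' hk
      · exact h1 k' (by omega)
    · -- piece `[b (2k+1), b (2k+2)] = [s k, t k]`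
      rw [hbs k (by omega), show 2 * k + 1 + 1 = 2 * k + 2 by ring, hbt k (by omega)]
      exact hst k (by omega)
  have hbN : b (2 * n + 1) = 1 := hb1
  -- the intermediate pieces are off the collar
  have hoff : ∀ k ≤ n, ∀ τ ∈ Icc (b (2 * k)) (b (2 * k + 1)),
      K (circlePt τ) ∉ φ '' (univ ×ˢ Icc (-(1 / 2) : ℝ) (1 / 2)) := by
    intro k hk τ hτ
    have hIcc := breakpoints_mem_Icc hb0 hbN hmono (i := 2 * k) (by omega)
    have hIcc' := breakpoints_mem_Icc hb0 hbN hmono (i := 2 * k + 1) (by omega)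
    refine hout τ ⟨hIcc.1.trans hτ.1, hτ.2.trans hIcc'.2⟩ fun k' hk' hτk' => ?_
    rcases lt_or_ge k' k with hlt | hge
    · have hle : t k' ≤ b (2 * k) := by
        obtain ⟨k₀, rfl⟩ : ∃ k₀, k = k₀ + 1 := ⟨k - 1, by omega⟩
        rw [show 2 * (k₀ + 1) = 2 * k₀ + 2 by ring, hbt k₀ (by omega)]
        exact (hmono_st k' hk' k₀ (by omega) (by omega)).2
      linarith [hτ.1, hτk'.2]
    · have hle : b (2 * k + 1) ≤ s k' := by
        rw [hbs k (by omega)]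
        exact (hmono_st k (by omega) k' hk' hge).1
      linarith [hτ.2, hτk'.1]
  -- the dichotomy for the pieces
  have hdes : ∀ i < 2 * n + 1,
      (∀ τ ∈ Icc (b i) (b (i + 1)), K (circlePt τ) ∈ φ '' (univ ×ˢ Ioo (-1 : ℝ) 1)) ∨
      (∀ τ ∈ Icc (b i) (b (i + 1)), K (circlePt τ) ∉ φ '' (univ ×ˢ Icc (-(1 / 2) : ℝ) (1 / 2))) := by
    intro i hi
    obtain ⟨k, rfl | rfl⟩ : ∃ k, i = 2 * k ∨ i = 2 * k + 1 := ⟨i / 2, by omega⟩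
    · exact Or.inr (hoff k (by omega))
    · left
      rw [hbs k (by omega), show 2 * k + 1 + 1 = 2 * k + 2 by ring, hbt k (by omega)]
      exact hin k (by omega)
  rw [crossingNumber_eq_sum_inside hc hφc hφ1 hφp hφi hK hKc b hb0 hbN hmono hdes,
    Finset.sum_range_parity]
  -- even pieces contribute nothing, odd pieces are the passages
  have heven : ∀ k ∈ Finset.range (n + 1),
      (if ∀ τ ∈ Icc (b (2 * k)) (b (2 * k + 1)), K (circlePt τ) ∈ φ '' (univ ×ˢ Ioo (-1 : ℝ) 1)
        then outerInd φ (K (circlePt (b (2 * k + 1)))) - outerInd φ (K (circlePt (b (2 * k))))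
        else (0 : ℤ)) = 0 := by
    intro k hk
    rw [Finset.mem_range] at hk
    split_ifs with hA
    · rw [outerInd_eq_of_piece hc hφc hφ1 hφp hφi hK (hmono (2 * k) (by omega)) hA
        (hoff k (by omega)), sub_self]
    · rfl
  have hodd : ∀ k ∈ Finset.range n,
      (if ∀ τ ∈ Icc (b (2 * k + 1)) (b (2 * k + 1 + 1)), K (circlePt τ) ∈ φ '' (univ ×ˢ Ioo (-1 : ℝ) 1)
        then outerInd φ (K (circlePt (b (2 * k + 1 + 1)))) - outerInd φ (K (circlePt (b (2 * k + 1))))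
        else (0 : ℤ)) =
      outerInd φ (K (circlePt (t k))) - outerInd φ (K (circlePt (s k))) := by
    intro k hk
    rw [Finset.mem_range] at hk
    rw [show 2 * k + 1 + 1 = 2 * k + 2 by ring, hbs k hk, hbt k hk, if_pos (hin k hk)]
  rw [Finset.sum_congr rfl heven, Finset.sum_const_zero, zero_add]
  exact Finset.sum_congr rfl hodd

/-! ## The registered form -/

/-- **Sub-goal `helper_crossingNumber_passages`** (Z6-8, a tool for the evaluation and symmetry
steps of the missing lemma of node N1a of NF4): a loop of the page making `n` clean passages
through the annulus of the chart — inside the open annulus on the increasing parameter intervals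
`[sₖ, tₖ] ⊆ [0, 1]`, off the closed collar outside the open intervals `(sₖ, tₖ)` — has crossing
number `Σₖ (outerInd φ (K e^{2πitₖ}) − outerInd φ (K e^{2πisₖ}))`, the number of climbing passages
minus the number of descending ones. [cite: Fulton1995, §3] -/
theorem helper_crossingNumber_passages : ∀ (g : ℕ) (c : ℂ) (_hc : ‖c‖ = 1) (φ : ℝ × ℝ → Literature.Topology.FourManifolds.LefschetzBase.Base g) (_hφc : Continuous φ) (_hφ1 : ∀ u r, φ (u + 1, r) = φ (u, r)) (_hφp : ∀ p, φ p ∈ Literature.Topology.FourManifolds.LefschetzBase.page g c) (_hφi : Set.InjOn φ (Set.Ico (0 : ℝ) 1 ×ˢ Set.Ioo (-1 : ℝ) 1)) (K : Metric.sphere (0 : EuclideanSpace ℝ (Fin 2)) 1 → Literature.Topology.FourManifolds.LefschetzBase.Base g) (_hK : Continuous K) (_hKc : ∀ θ, K θ ∈ Literature.Topology.FourManifolds.LefschetzBase.page g c) (n : ℕ) (s t : ℕ → ℝ), 0 ≤ s 0 → (∀ k < n, s k ≤ t k) → (∀ k, k + 1 < n → t k ≤ s (k + 1)) → (∀ k <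 n, t k ≤ 1) → (∀ k < n, ∀ τ ∈ Set.Icc (s k) (t k), K (Literature.Topology.FourManifolds.circlePt τ) ∈ φ '' (Set.univ ×ˢ Set.Ioo (-1 : ℝ) 1)) → (∀ τ ∈ Set.Icc (0 : ℝ) 1, (∀ k < n, τ ∉ Set.Ioo (s k) (t k)) → K (Literature.Topology.FourManifolds.circlePt τ) ∉ φ '' (Set.univ ×ˢ Set.Icc (-(1 / 2) : ℝ) (1 / 2))) → Summit.SmoothPoincare4.SmoothPoincare4.Theorems.AcyclicBisectionExists.ModpBraidOrbits.crossingNumber φ K = ∑ k ∈ Finset.range n, (Summit.SmoothPoincare4.SmoothPoincare4.Theorems.AcyclicBisectionExists.ModpBraidOrbits.outerInd φ (K (Literature.Topology.FourManifolds.circlePt (t k))) - Summit.SmoothPoincare4.SmoothPoincare4.Theorems.AcyclicBisectionExists.ModpBraidOrbits.outerInd φ (K (Literature.Topology.FourManifolds.circlePt (s k)))) :=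
  fun _ _ hc _ hφc hφ1 hφp hφi _ hK hKc _ s t h0 hst hts h1 hin hout =>
    crossingNumber_eq_sum_passages hc hφc hφ1 hφp hφi hK hKc s t h0 hst hts h1 hin hout

end Summit.SmoothPoincare4.SmoothPoincare4.Theorems.AcyclicBisectionExists.ModpBraidOrbits

end
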